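import Summits.QuantumFields.YangMills.Theorems.BalabanUVNodesN15TwoSpacingGluingAdjointDefectGluingCutOut
import Summits.QuantumFields.YangMills.Theorems.BalabanUVNodesN15CurvedGluingCubeSmoothCutDressedAdjointRowSandwich
import HarnessLib

/-!
# THE ADJOINT RESUMMATION OF THE DRESSED SMOOTH-CUT CUBES WITH THEIR TRUE RIGHT-LOCALITY DEFECTS `Ẽ_k = X_k∘Δ∘M_{h_k} − M_{h_k}` (displayed rows) IS THE TWO-SIDED INVERSE OF THE GLOBAL
# OPERATOR IN THE GLOBAL GAUGE, HENCE EQUALS EVERY RIGHT INVERSE `Y` (FILE 147 uniqueness); the per-cube adjoint remainder row against the GLOBAL operator (FILE 153 ★★★ + the far row)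
# (dag-n15-c g19, FILE 167; N15 = NE2, s1 road (c) — the typed home of FLAG №13's located burden)

Cell `pub-ymgap`, seat `pub-ymgap-dag-n15-c` (R134 (a); HUMAN RULING D-0062), generation 19.  `bears_on: R4∕N15 · K3⁸ SpineGivenEndpointR13SepCoPHV (stmt-QuantumFields-27366)`.
Filed `--kind proof --supports stmt-QuantumFields-27366 --as helper` — COUNT-NEUTRAL.  Theorems only; 0 `def`, 0 `sorry`.  Imports BY NAME FILE 158 `…AdjointDefectGluingCutOut`
(`hasMaj_remainderLD_out`; through it FILE 147 `glued_adjoint_inverse_of_defect`, `glueInvL_eq_of_lap_comp`) and FILE 153 `…CubeSmoothCutDressedAdjointRowSandwich`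
(★★★ `hasMaj_smoothCutDressed_comp_commOp_cubeOp_out_of_sandwich`; through it file 34, file 23, FILE 148, FILE 150, dag-n15-c `commOp_add_left`).  Nothing in the tree is modified; nothing restated.

WHY (g18 FINDINGS (iii), (viii)–(x); g19).  FILE 163 glued the dressed smooth-cut cubes `X_k` ADJOINTLY (per-cube gauges) and bounded `𝒵∘∇⁻_ν` for `𝒵 = (1 − R̃_D)⁻¹G₀` with the subtracted defect
HARD-WIRED as `X_kF_kM_{h_k}` (which is `0`, FILE 166).  The node needs the entry for THE inverse `𝒢 = cvGlued`; `𝒵 = 𝒢` (FILE 147 uniqueness) requires `𝒵∘Δ = 1`, i.e. the per-cube right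
locality `X_k∘Δ∘M_{h_k} = M_{h_k} + Ẽ_k` with the TRUE defect `Ẽ_k` inside `R̃_D` — at the cover `Ẽ_k ≠ 0`: the flat nonlocal part `∂Π∂*` leaks out of the images cube, `Ẽ_k = Ñ_{𝒲_k}∘F^flat_k`
(FILE 148 `projO_dressedV_comp_lap_mulOp`), an exponentially small ADJOINT TAIL in the margin (the twin of dag-n15-w3 52's tail rows `hT`).  THIS FILE works in the GLOBAL gauge (`u ≡ 1`, the
honest class of FILES 129–146: no gauge sandwiches, `W = 0`), reads the global operator in each cube as `Δ = model_k + F_k` (FILE 166 ∕ file 49 produce the split and the far row), DISPLAYS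
`Ẽ_k` by its row, and proves `𝒵∘Δ = 1 = Δ∘𝒵` hence `𝒵 = Y` for ANY right inverse `Y` of `Δ` (at the cover `cvGlued`, FILE 133).  Its ★ is FILE 158's `hKc` for the global operator.

WHAT.  ★ `hasMaj_smoothCutDressed_comp_commOp_global` (`X_k∘[Δ, M_{h_k}] ≤ 1_S(y)·Θ′e^{−ρ₃d}`, `Θ′ = Θ₁₅₃ + θ_F`: FILE 153 ★★★ for the model operator + the displayed far row); ★★
`glued_adjoint_inverse_trueDefect` (`𝒵∘Δ = 1 ∧ Δ∘𝒵 = 1` under ONE smallness `N_ov(Θ′ + ε_E)c_r < 1`); ★★ `glued_adjoint_eq_rightInverse` (`𝒵 = Y`).  Data per cube `k`: file 34's cube data, the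
flat cube's SANDWICHED right entries `N_k∘∇^±_μ∘M_{χ_k} = T^±∘M_{χ_k}` (rows `β^Q`, input cuts `ψ₂`), the cut perturbation `V̂_k = unstackM C_k A_k + N_{V,k}∘pr₀` (letter `R`, species rows `r_A`,
base row `R_N`), the adjoint letter `𝒲_k ≤ θ_𝒲e^{−δ_Wd}`, the partition (letters `c₀, c₁, c₂`, block reading, transition layers inside `{χ_k = 1}`, `|h| ≤ 1`, `Σ_kh_k² = 1`), `[N_L, M_h] ≤ c_Ne^{−ρ_Nd}`,
overlap `N_ov`, the split `Δ = (Δ₀ + N_L − V̂_k∘jet) + F_k` with the far commutator row `X_k∘[F_k, M_{h_k}] ≤ 1_S(y)θ_Fe^{−ρ₃d}` (FILE 166: from ONE far letter, `= 0` in the small-field class), the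
TRUE right-locality defects `Ẽ_k` by their rows `ε_E`.  FILE 168 feeds these into FILE 158 ★★ (entry 2), FILE 169 into FILE 158 ★★★ (its η-rate).

HONEST FRAMING ∕ LIMITS.  Composition of LANDED theorems over DISPLAYED rows — the operator-level content of entry 2 of (3.42) in the global small-field gauge as a CONDITIONAL statement on King's ∕
dag-n15-a's model carriers; proves NO estimate of a concrete propagator; nothing of [B5]∕[B6]∕[B9] asserted ((2.91)–(2.93) p.239, (2.133)–(2.136) p.247, (3.42) p.397, (3.52) p.400, (3.62)–(3.65)
pp.402–403, (3.76)–(3.77) pp.405–406 = SHAPES ∕ MECHANISM).  NE2 for non-abelian `G(U)` NOT proved (C-N15-1); N15 booked «discharged AS CONSUMED at the U-blind v7 pin» (№253) — this file is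
road (c)'s bookkeeping and moves NO count; K3⁸ skeleton untouched; one finite 𝕋⁴ at fixed ε — NOT infinite volume, NOT OS on ℝ⁴, NOT a mass gap, NOT Clay.  Restate-immune (no Theses import).
-/

set_option autoImplicit false

noncomputable section
open scoped BigOperators Matrix
open Finset

namespace Summit.QuantumFields.YangMills.BalabanUVNodes.N15.Gluing

open Literature.MathematicalPhysics.QuantumFieldTheory.Balaban1983to89
open Literature.MathematicalPhysics.QuantumFieldTheory.Balaban1983to89.B11SectG (BlockNorm HasMaj RowSum hasMaj_zero)
open Literature.MathematicalPhysics.QuantumFieldTheory.Balaban1983to89.B6RandomWalk (Triangle254)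
open Literature.MathematicalPhysics.QuantumFieldTheory.Balaban1983to89.T4EtaRateCoeffDefect (diagK diagK_nonneg hasMaj_mulOp)
open Literature.MathematicalPhysics.QuantumFieldTheory.Balaban1983to89.B6Prop26Gluing (mulOp mulOp_apply ind ind_nonneg ind_le_one)
open Summit.QuantumFields.YangMills.BalabanUVNodes.N15.MatrixSpecies (mmulOp liftBlk liftEquiv liftEquiv_apply liftEquiv_symm_apply)
open Summit.QuantumFields.YangMills.BalabanUVNodes.N15.BackgroundLayer (fgrad bgrad fgradAdj fgrad_apply bgrad_apply stack projO unstackM bgPropV blkPair)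
open Summit.QuantumFields.YangMills.BalabanUVNodes.N15.CurvedSpecies (hasMaj_smoothCutDressed_loc₂ mulOp_comp_smoothCutDressed hasMaj_smoothCut_flat hasMaj_jet_smoothCut_flat smoothCut_out
  hasMaj_dressedV_pair)

section Capstone

variable {X ι J K : Type} [Fintype X] [DecidableEq X] [Fintype ι] [DecidableEq ι] [Fintype J] [DecidableEq J] [Fintype K] {g : B6.Geometry} (blk : X → g.Site) (τ : J → X ≃ X) (n : ℝ)
  {σ cr : ℝ} {N : K → (X × ι → ℝ) →ₗ[ℝ] (X × ι → ℝ)} {Cc : K → X → Matrix ι ι ℝ} {Ac : K → J ⊕ J → X → Matrix ι ι ℝ}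
  {NVc Ed F : K → (X × ι → ℝ) →ₗ[ℝ] (X × ι → ℝ)} {Δ NL Yop : (X × ι → ℝ) →ₗ[ℝ] (X × ι → ℝ)} {χX χtX ψX ψ₂X hX : K → X → ℝ} {Sk : K → Set g.Site}
  {hb : K → g.Site → ℝ} {Tf Tb : K → J → (X × ι → ℝ) →ₗ[ℝ] (X × ι → ℝ)}

omit [Fintype K] in
set_option maxHeartbeats 400000 in
/-- ★ **THE ADJOINT REMAINDER ROW OF THE DRESSED SMOOTH-CUT CUBE AGAINST THE GLOBAL OPERATOR**: FILE 153 ★★★ against the cube's model operator `Δ₀ + N_L − V̂_k∘jet` plus the displayed far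
commutator row, through the split `Δ = model_k + F_k`: `X_k∘[Δ, M_{h_k}] ≤ 1_S(y)·Θ′e^{−ρ₃d}`, `Θ′ = Θ₁₅₃ + θ_F` — FILE 158's `hKc` for the GLOBAL operator (FILE 163's step (5) without gauges).
[cite: Balaban1984PropagatorsI, (1.120)–(1.128) pp.37–39; Balaban1984PropagatorsII, (2.91)–(2.93) p.239, (2.133)–(2.135) p.247 (shapes + mechanism, transposed); Balaban1985BackgroundPropagators, (3.34)–(3.35) p.396, (3.52) p.400, (3.62)–(3.65) pp.402–403, (3.76)–(3.77) pp.405–406] -/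
theorem hasMaj_smoothCutDressed_comp_commOp_global (htri : Triangle254 g) (hd : ∀ a b : g.Site, 0 ≤ g.dist a b) (hsymm : ∀ y y', g.dist y y' = g.dist y' y) (hd0 : ∀ y : g.Site, g.dist y y = 0) (hrow : RowSum g σ cr) (hσ : 0 ≤ σ)
    {ρ₁ ρ₂ ρ₃ ρN δV δN δW ε R c₀ c₁ c₂ cN rA RN ℓ ω β β₁ ct δ βQ θA θF : ℝ} (hβ : 0 ≤ β) (hβ₁ : 0 ≤ β₁) (hβQ : 0 ≤ βQ) (hct : 0 ≤ ct) (hR : 0 ≤ R) (hcr : 0 ≤ cr) (hc₀ : 0 ≤ c₀) (hc₁ : 0 ≤ c₁)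
    (hc₂ : 0 ≤ c₂) (hcN : 0 ≤ cN) (hrA : 0 ≤ rA) (hRN : 0 ≤ RN) (hℓ : 0 ≤ ℓ) (hω : 0 ≤ ω) (hθA : 0 ≤ θA) (hε : 0 < ε) (hσρ : σ ≤ ρ₁) (hρ₁V : ρ₁ ≤ δV) (hρ₁G : ρ₁ + σ ≤ δ)
    (hρ₂ : 0 ≤ ρ₂) (hρ₂₁ : ρ₂ + σ ≤ ρ₁) (hρ₃ : 0 ≤ ρ₃) (hρ₃N : ρ₃ ≤ ρN) (hρ₃V : ρ₃ ≤ δN - ε) (hρ₃₂ : ρ₃ + σ ≤ ρ₂) (hρ₂W : ρ₂ + 2 * σ ≤ δW)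
    -- per cube: cuts (supports over `S_k`, bump letters and insertions, input cuts)
    (hSχ : ∀ k x, χX k x ≠ 0 → blk x ∈ Sk k) (hSψ : ∀ k x, ψX k x ≠ 0 → blk x ∈ Sk k) (hSψ₂ : ∀ k x, ψ₂X k x ≠ 0 → blk x ∈ Sk k) (hχt : ∀ k x, |χtX k x| ≤ 1)
    (hdχt : ∀ k μ p, |fgrad n (liftEquiv (τ μ) ι) (fun p : X × ι => χtX k p.1) p| ≤ ct) (hdχtb : ∀ k μ p, |bgrad n (liftEquiv (τ μ) ι) (fun p : X × ι => χtX k p.1) p| ≤ ct)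
    (hsub : ∀ k, mulOp (fun p : X × ι => χtX k p.1) ∘ₗ mulOp (fun p : X × ι => χX k p.1) = mulOp (fun p : X × ι => χtX k p.1))
    (hχ : ∀ k, mulOp (fun p : X × ι => χX k p.1) ∘ₗ mulOp (fun p : X × ι => χtX k p.1) = mulOp (fun p : X × ι => χtX k p.1))
    (hs : ∀ k μ, mulOp ((fun p : X × ι => χtX k p.1) ∘ (liftEquiv (τ μ) ι)) ∘ₗ mulOp (fun p : X × ι => χX k p.1) = mulOp ((fun p : X × ι => χtX k p.1) ∘ (liftEquiv (τ μ) ι)))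
    (hsb : ∀ k μ, mulOp ((fun p : X × ι => χtX k p.1) ∘ (liftEquiv (τ μ) ι).symm) ∘ₗ mulOp (fun p : X × ι => χX k p.1) = mulOp ((fun p : X × ι => χtX k p.1) ∘ (liftEquiv (τ μ) ι).symm))
    (hdd : ∀ k μ, mulOp (fgrad n (liftEquiv (τ μ) ι) (fun p : X × ι => χtX k p.1)) ∘ₗ mulOp (fun p : X × ι => χX k p.1) = mulOp (fgrad n (liftEquiv (τ μ) ι) (fun p : X × ι => χtX k p.1)))
    (hddb : ∀ k μ, mulOp (bgrad n (liftEquiv (τ μ) ι) (fun p : X × ι => χtX k p.1)) ∘ₗ mulOp (fun p : X × ι => χX k p.1) = mulOp (bgrad n (liftEquiv (τ μ) ι) (fun p : X × ι => χtX k p.1)))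
    (hNψ : ∀ k, N k ∘ₗ mulOp (fun p : X × ι => ψX k p.1) = N k)
    -- per cube: the flat cube's cut rows, SANDWICHED right entries with rows and input cuts
    (hcut : ∀ k, HasMaj (BlockNorm.ofBlocks g (liftBlk blk ι)) (BlockNorm.ofBlocks g (liftBlk blk ι)) (mulOp (fun p : X × ι => χX k p.1) ∘ₗ N k) (fun y y' => ind (Sk k) y * ind (Sk k) y' * (β * Real.exp (-(δ * g.dist y y')))))
    (hcutF : ∀ k μ, HasMaj (BlockNorm.ofBlocks g (liftBlk blk ι)) (BlockNorm.ofBlocks g (liftBlk blk ι)) (mulOp (fun p : X × ι => χX k p.1) ∘ₗ (fgrad n (liftEquiv (τ μ) ι) ∘ₗ N k)) (fun y y' => ind (Sk k) y * ind (Sk k) y' * (β₁ * Real.exp (-(δ * g.dist y y')))))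
    (hcutB : ∀ k μ, HasMaj (BlockNorm.ofBlocks g (liftBlk blk ι)) (BlockNorm.ofBlocks g (liftBlk blk ι)) (mulOp (fun p : X × ι => χX k p.1) ∘ₗ (bgrad n (liftEquiv (τ μ) ι) ∘ₗ N k)) (fun y y' => ind (Sk k) y * ind (Sk k) y' * (β₁ * Real.exp (-(δ * g.dist y y')))))
    (hTf : ∀ k μ, N k ∘ₗ fgrad n (liftEquiv (τ μ) ι) ∘ₗ mulOp (fun p : X × ι => χX k p.1) = Tf k μ ∘ₗ mulOp (fun p : X × ι => χX k p.1))
    (hTb : ∀ k μ, N k ∘ₗ bgrad n (liftEquiv (τ μ) ι) ∘ₗ mulOp (fun p : X × ι => χX k p.1) = Tb k μ ∘ₗ mulOp (fun p : X × ι => χX k p.1))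
    (hTfr : ∀ k μ, HasMaj (BlockNorm.ofBlocks g (liftBlk blk ι)) (BlockNorm.ofBlocks g (liftBlk blk ι)) (Tf k μ) (fun y y' => ind (Sk k) y * ind (Sk k) y' * (βQ * Real.exp (-(δW * g.dist y y')))))
    (hTbr : ∀ k μ, HasMaj (BlockNorm.ofBlocks g (liftBlk blk ι)) (BlockNorm.ofBlocks g (liftBlk blk ι)) (Tb k μ) (fun y y' => ind (Sk k) y * ind (Sk k) y' * (βQ * Real.exp (-(δW * g.dist y y')))))
    (hTfψ : ∀ k μ, Tf k μ ∘ₗ mulOp (fun p : X × ι => ψ₂X k p.1) = Tf k μ) (hTbψ : ∀ k μ, Tb k μ ∘ₗ mulOp (fun p : X × ι => ψ₂X k p.1) = Tb k μ)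
    -- per cube: the cut perturbation's letter, smallness, the adjoint letter of `𝒲_k`
    (hV : ∀ k, HasMaj (BlockNorm.ofBlocks g (blkPair (liftBlk blk ι))) (BlockNorm.ofBlocks g (liftBlk blk ι)) (unstackM (Cc k) (Ac k) + NVc k ∘ₗ projO (none : Option (J ⊕ J))) (fun y y' => R * Real.exp (-(δV * g.dist y y'))))
    (hq : (β + (β₁ + ct * β)) * (R * cr) * cr < 1)
    (hW𝒲 : ∀ k, HasMaj (BlockNorm.ofBlocks g (liftBlk blk ι)) (BlockNorm.ofBlocks g (liftBlk blk ι))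
      ((mulOp (fun p : X × ι => χtX k p.1) ∘ₗ N k) ∘ₗ (unstackM (Cc k) (Ac k) + NVc k ∘ₗ projO (none : Option (J ⊕ J))) ∘ₗ
        stack LinearMap.id (fun j => Sum.elim (fun μ => fgrad n (liftEquiv (τ μ) ι)) (fun μ => bgrad n (liftEquiv (τ μ) ι)) j) ∘ₗ mulOp (fun p : X × ι => χX k p.1))
      (fun y y' => θA * Real.exp (-(δW * g.dist y y'))))
    (hqA : θA * cr < 1)
    -- per cube: the partition, its supports inside `ψ_k`, `χ_k` and its transition layers inside the cut (also shifted by `e_ν`); the partition of unity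
    (hh1 : ∀ k μ x, |fgrad n (τ μ) (hX k) x| ≤ c₁) (hh1b : ∀ k μ x, |bgrad n (τ μ) (hX k) x| ≤ c₁) (hh0 : ∀ k μ x, |hX k (τ μ x) - hX k x| ≤ c₀)
    (hLip : ∀ k y y', |hb k y - hb k y'| ≤ ℓ * g.dist y y') (hrh : ∀ k x, |hX k x - hb k (blk x)| ≤ ω)
    (hh2 : ∀ k μ p, |fgradAdj n (liftEquiv (τ μ) ι) (fgrad n (liftEquiv (τ μ) ι) (fun p : X × ι => hX k p.1)) p| ≤ c₂)
    (hh2f : ∀ k μ p, |fgrad n (liftEquiv (τ μ) ι) (fgrad n (liftEquiv (τ μ) ι) (fun p : X × ι => hX k p.1)) p| ≤ c₂)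
    (hh2b : ∀ k μ p, |bgrad n (liftEquiv (τ μ) ι) (bgrad n (liftEquiv (τ μ) ι) (fun p : X × ι => hX k p.1) ∘ ⇑(liftEquiv (τ μ) ι)) p| ≤ c₂)
    (hlayf : ∀ k μ x, hX k x ≠ hX k ((τ μ).symm x) → χX k x = 1) (hlayb : ∀ k μ x, hX k (τ μ x) ≠ hX k x → χX k x = 1)
    -- per cube: species rows of the cut coefficients, the flat nonlocal commutator letter, base part; overlap
    (hA : ∀ k j x i, ∑ l, |Ac k j x i l| ≤ rA)
    (hKN : ∀ k, HasMaj (BlockNorm.ofBlocks g (liftBlk blk ι)) (BlockNorm.ofBlocks g (liftBlk blk ι)) (commOp NL (fun p : X × ι => hX k p.1)) (fun y y' => cN * Real.exp (-(ρN * g.dist y y'))))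
    (hNV : ∀ k, HasMaj (BlockNorm.ofBlocks g (liftBlk blk ι)) (BlockNorm.ofBlocks g (liftBlk blk ι)) (NVc k) (fun y y' => RN * Real.exp (-(δN * g.dist y y'))))
    -- THE GLOBAL OPERATOR read in cube `k` = the cube's model operator + a far defect `F_k`; its adjoint commutator row; the TRUE right-locality defect and its row; a right inverse
    (hcov : ∀ k, Δ = (lapOp n (fun μ => liftEquiv (τ μ) ι) 0 + NL - (unstackM (Cc k) (Ac k) + NVc k ∘ₗ projO (none : Option (J ⊕ J))) ∘ₗ
      stack LinearMap.id (fun j => Sum.elim (fun μ => fgrad n (liftEquiv (τ μ) ι)) (fun μ => bgrad n (liftEquiv (τ μ) ι)) j)) + F k)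
    (hFK : ∀ k, HasMaj (BlockNorm.ofBlocks g (liftBlk blk ι)) (BlockNorm.ofBlocks g (liftBlk blk ι)) ((projO none ∘ₗ bgPropV (stack (mulOp (fun p : X × ι => χtX k p.1) ∘ₗ N k) (fun j => Sum.elim (fun μ => fgrad n (liftEquiv (τ μ) ι)) (fun μ => bgrad n (liftEquiv (τ μ) ι)) j ∘ₗ (mulOp (fun p : X × ι => χtX k p.1) ∘ₗ N k))) (unstackM (Cc k) (Ac k) + NVc k ∘ₗ projO (none : Option (J ⊕ J)))) ∘ₗ commOp (F k) (fun p : X × ι => hX k p.1))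
      (fun y y' => ind (Sk k) y * (θF * Real.exp (-(ρ₃ * g.dist y y'))))) (k : K) :
    HasMaj (BlockNorm.ofBlocks g (liftBlk blk ι)) (BlockNorm.ofBlocks g (liftBlk blk ι)) ((projO none ∘ₗ bgPropV (stack (mulOp (fun p : X × ι => χtX k p.1) ∘ₗ N k) (fun j => Sum.elim (fun μ => fgrad n (liftEquiv (τ μ) ι)) (fun μ => bgrad n (liftEquiv (τ μ) ι)) j ∘ₗ (mulOp (fun p : X × ι => χtX k p.1) ∘ₗ N k))) (unstackM (Cc k) (Ac k) + NVc k ∘ₗ projO (none : Option (J ⊕ J)))) ∘ₗ commOp Δ (fun p : X × ι => hX k p.1))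
      (fun y y' => ind (Sk k) y * ((((((Fintype.card J : ℝ) * (3 * ((β + (β₁ + ct * β)) * (1 - (β + (β₁ + ct * β)) * (R * cr) * cr)⁻¹ * c₂) + 2 * (((1 - θA * cr)⁻¹ * βQ * cr) * c₁)) + 0)
          + (β + (β₁ + ct * β)) * (1 - (β + (β₁ + ct * β)) * (R * cr) * cr)⁻¹ * cN * cr)
        + (((Fintype.card J : ℝ) * (2 * rA * (c₁ * ((β + (β₁ + ct * β)) * (1 - (β + (β₁ + ct * β)) * (R * cr) * cr)⁻¹) + c₀ * ((1 - θA * cr)⁻¹ * βQ * cr))))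
          + (β + (β₁ + ct * β)) * (1 - (β + (β₁ + ct * β)) * (R * cr) * cr)⁻¹ * ((ℓ * (Real.exp 1 * ε)⁻¹ + 2 * ω) * RN) * cr)) + θF) * Real.exp (-(ρ₃ * g.dist y y')))) := by
  have hWrow : HasMaj (BlockNorm.ofBlocks g (liftBlk blk ι)) (BlockNorm.ofBlocks g (liftBlk blk ι)) ((projO none ∘ₗ bgPropV (stack (mulOp (fun p : X × ι => χtX k p.1) ∘ₗ N k) (fun j => Sum.elim (fun μ => fgrad n (liftEquiv (τ μ) ι)) (fun μ => bgrad n (liftEquiv (τ μ) ι)) j ∘ₗ (mulOp (fun p : X × ι => χtX k p.1) ∘ₗ N k))) (unstackM (Cc k) (Ac k) + NVc k ∘ₗ projO (none : Option (J ⊕ J)))) ∘ₗ commOp (0 : (X × ι → ℝ) →ₗ[ℝ] (X × ι → ℝ)) (fun p : X × ι => hX k p.1)) (fun y y' => ind (Sk k) y * ind (Sk k) y' * (0 * Real.exp (-(ρ₂ * g.dist y y')))) := by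
    rw [show commOp (0 : (X × ι → ℝ) →ₗ[ℝ] (X × ι → ℝ)) (fun p : X × ι => hX k p.1) = 0 from by simp [commOp], LinearMap.comp_zero]
    exact (hasMaj_zero _ _).mono fun y y' => le_of_eq (by ring)
  rw [hcov k, commOp_add_left, LinearMap.comp_add]
  have h153 := hasMaj_smoothCutDressed_comp_commOp_cubeOp_out_of_sandwich blk τ n htri hd hsymm hd0 hrow hσ hβ hβ₁ hβQ hct hR hcr hc₀ hc₁ hc₂ (le_refl (0 : ℝ)) hcN hrA hRN hℓ hω hθA hε
    hσρ hρ₁V hρ₁G hρ₂ hρ₂₁ hρ₃ hρ₃N hρ₃V hρ₃₂ hρ₂W (hSχ k) (hSψ k) (hSψ₂ k) (hχt k) (hdχt k) (hdχtb k) (hsub k) (hχ k) (hs k) (hsb k) (hdd k) (hddb k) (hNψ k)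
    (hcut k) (hcutF k) (hcutB k) (hTf k) (hTb k) (hTfr k) (hTbr k) (hTfψ k) (hTbψ k) (hV k) hq (hW𝒲 k) hqA (hh1 k) (hh1b k) (hh0 k) (hLip k) (hrh k) (hh2 k) (hh2f k) (hh2b k)
    (hlayf k) (hlayb k) (hA k) hWrow (hKN k) (hNV k)
  exact (h153.add (hFK k)).mono fun y y' => le_of_eq (by ring)

set_option maxHeartbeats 800000 in
/-- ★★ **THE ADJOINT GLUED OPERATOR WITH THE TRUE RIGHT-LOCALITY DEFECTS IS THE TWO-SIDED INVERSE OF THE GLOBAL OPERATOR** (FILE 147 `glued_adjoint_inverse_of_defect` with ★'s rows, the defect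
rows `Ẽ_k ≤ 1_S1_S·ε_Ee^{−ρ₃d}`, `|h| ≤ 1`, `Σ_kh_k² = 1`, overlap `N_ov`, ONE smallness `N_ov(Θ′ + ε_E)c_r < 1`): `𝒵∘Δ = 1 ∧ Δ∘𝒵 = 1`, `𝒵 = glueInvL (R̃ − Σ_kM_{h_k}Ẽ_k) (Σ_kM_{h_k}X_kM_{h_k})`.
[cite: Balaban1984PropagatorsII, (2.91)–(2.93) p.239, p.247 («G = G₀(I − R)⁻¹»: mechanism, transposed); Balaban1985BackgroundPropagators, (3.87) p.409, Cor. 3.6 p.408] -/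
theorem glued_adjoint_inverse_trueDefect (htri : Triangle254 g) (hd : ∀ a b : g.Site, 0 ≤ g.dist a b) (hsymm : ∀ y y', g.dist y y' = g.dist y' y) (hd0 : ∀ y : g.Site, g.dist y y = 0) (hrow : RowSum g σ cr) (hσ : 0 ≤ σ)
    {ρ₁ ρ₂ ρ₃ ρN δV δN δW ε R c₀ c₁ c₂ cN rA RN ℓ ω β β₁ ct δ βQ θA θF εE Nov : ℝ} (hβ : 0 ≤ β) (hβ₁ : 0 ≤ β₁) (hβQ : 0 ≤ βQ) (hct : 0 ≤ ct) (hR : 0 ≤ R) (hcr : 0 ≤ cr) (hc₀ : 0 ≤ c₀)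
    (hc₁ : 0 ≤ c₁) (hc₂ : 0 ≤ c₂) (hcN : 0 ≤ cN) (hrA : 0 ≤ rA) (hRN : 0 ≤ RN) (hℓ : 0 ≤ ℓ) (hω : 0 ≤ ω) (hθA : 0 ≤ θA) (hθF : 0 ≤ θF) (hεE : 0 ≤ εE) (hNov : 0 ≤ Nov) (hε : 0 < ε) (hσρ : σ ≤ ρ₁)
    (hρ₁V : ρ₁ ≤ δV) (hρ₁G : ρ₁ + σ ≤ δ) (hρ₂ : 0 ≤ ρ₂) (hρ₂₁ : ρ₂ + σ ≤ ρ₁) (hρ₃ : 0 ≤ ρ₃) (hρ₃N : ρ₃ ≤ ρN) (hρ₃V : ρ₃ ≤ δN - ε) (hρ₃₂ : ρ₃ + σ ≤ ρ₂) (hρ₂W : ρ₂ + 2 * σ ≤ δW)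
    (hσρ₃ : 2 * σ ≤ ρ₃)
    -- per cube: cuts (supports over `S_k`, bump letters and insertions, input cuts)
    (hSχ : ∀ k x, χX k x ≠ 0 → blk x ∈ Sk k) (hSψ : ∀ k x, ψX k x ≠ 0 → blk x ∈ Sk k) (hSψ₂ : ∀ k x, ψ₂X k x ≠ 0 → blk x ∈ Sk k) (hχt : ∀ k x, |χtX k x| ≤ 1)
    (hdχt : ∀ k μ p, |fgrad n (liftEquiv (τ μ) ι) (fun p : X × ι => χtX k p.1) p| ≤ ct) (hdχtb : ∀ k μ p, |bgrad n (liftEquiv (τ μ) ι) (fun p : X × ι => χtX k p.1) p| ≤ ct)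
    (hsub : ∀ k, mulOp (fun p : X × ι => χtX k p.1) ∘ₗ mulOp (fun p : X × ι => χX k p.1) = mulOp (fun p : X × ι => χtX k p.1))
    (hχ : ∀ k, mulOp (fun p : X × ι => χX k p.1) ∘ₗ mulOp (fun p : X × ι => χtX k p.1) = mulOp (fun p : X × ι => χtX k p.1))
    (hs : ∀ k μ, mulOp ((fun p : X × ι => χtX k p.1) ∘ (liftEquiv (τ μ) ι)) ∘ₗ mulOp (fun p : X × ι => χX k p.1) = mulOp ((fun p : X × ι => χtX k p.1) ∘ (liftEquiv (τ μ) ι)))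
    (hsb : ∀ k μ, mulOp ((fun p : X × ι => χtX k p.1) ∘ (liftEquiv (τ μ) ι).symm) ∘ₗ mulOp (fun p : X × ι => χX k p.1) = mulOp ((fun p : X × ι => χtX k p.1) ∘ (liftEquiv (τ μ) ι).symm))
    (hdd : ∀ k μ, mulOp (fgrad n (liftEquiv (τ μ) ι) (fun p : X × ι => χtX k p.1)) ∘ₗ mulOp (fun p : X × ι => χX k p.1) = mulOp (fgrad n (liftEquiv (τ μ) ι) (fun p : X × ι => χtX k p.1)))
    (hddb : ∀ k μ, mulOp (bgrad n (liftEquiv (τ μ) ι) (fun p : X × ι => χtX k p.1)) ∘ₗ mulOp (fun p : X × ι => χX k p.1) = mulOp (bgrad n (liftEquiv (τ μ) ι) (fun p : X × ι => χtX k p.1)))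
    (hNψ : ∀ k, N k ∘ₗ mulOp (fun p : X × ι => ψX k p.1) = N k)
    -- per cube: the flat cube's cut rows, SANDWICHED right entries with rows and input cuts
    (hcut : ∀ k, HasMaj (BlockNorm.ofBlocks g (liftBlk blk ι)) (BlockNorm.ofBlocks g (liftBlk blk ι)) (mulOp (fun p : X × ι => χX k p.1) ∘ₗ N k) (fun y y' => ind (Sk k) y * ind (Sk k) y' * (β * Real.exp (-(δ * g.dist y y')))))
    (hcutF : ∀ k μ, HasMaj (BlockNorm.ofBlocks g (liftBlk blk ι)) (BlockNorm.ofBlocks g (liftBlk blk ι)) (mulOp (fun p : X × ι => χX k p.1) ∘ₗ (fgrad n (liftEquiv (τ μ) ι) ∘ₗ N k)) (fun y y' => ind (Sk k) y * ind (Sk k) y' * (β₁ * Real.exp (-(δ * g.dist y y')))))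
    (hcutB : ∀ k μ, HasMaj (BlockNorm.ofBlocks g (liftBlk blk ι)) (BlockNorm.ofBlocks g (liftBlk blk ι)) (mulOp (fun p : X × ι => χX k p.1) ∘ₗ (bgrad n (liftEquiv (τ μ) ι) ∘ₗ N k)) (fun y y' => ind (Sk k) y * ind (Sk k) y' * (β₁ * Real.exp (-(δ * g.dist y y')))))
    (hTf : ∀ k μ, N k ∘ₗ fgrad n (liftEquiv (τ μ) ι) ∘ₗ mulOp (fun p : X × ι => χX k p.1) = Tf k μ ∘ₗ mulOp (fun p : X × ι => χX k p.1))
    (hTb : ∀ k μ, N k ∘ₗ bgrad n (liftEquiv (τ μ) ι) ∘ₗ mulOp (fun p : X × ι => χX k p.1) = Tb k μ ∘ₗ mulOp (fun p : X × ι => χX k p.1))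
    (hTfr : ∀ k μ, HasMaj (BlockNorm.ofBlocks g (liftBlk blk ι)) (BlockNorm.ofBlocks g (liftBlk blk ι)) (Tf k μ) (fun y y' => ind (Sk k) y * ind (Sk k) y' * (βQ * Real.exp (-(δW * g.dist y y')))))
    (hTbr : ∀ k μ, HasMaj (BlockNorm.ofBlocks g (liftBlk blk ι)) (BlockNorm.ofBlocks g (liftBlk blk ι)) (Tb k μ) (fun y y' => ind (Sk k) y * ind (Sk k) y' * (βQ * Real.exp (-(δW * g.dist y y')))))
    (hTfψ : ∀ k μ, Tf k μ ∘ₗ mulOp (fun p : X × ι => ψ₂X k p.1) = Tf k μ) (hTbψ : ∀ k μ, Tb k μ ∘ₗ mulOp (fun p : X × ι => ψ₂X k p.1) = Tb k μ)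
    -- per cube: the cut perturbation's letter, smallness, the adjoint letter of `𝒲_k`
    (hV : ∀ k, HasMaj (BlockNorm.ofBlocks g (blkPair (liftBlk blk ι))) (BlockNorm.ofBlocks g (liftBlk blk ι)) (unstackM (Cc k) (Ac k) + NVc k ∘ₗ projO (none : Option (J ⊕ J))) (fun y y' => R * Real.exp (-(δV * g.dist y y'))))
    (hq : (β + (β₁ + ct * β)) * (R * cr) * cr < 1)
    (hW𝒲 : ∀ k, HasMaj (BlockNorm.ofBlocks g (liftBlk blk ι)) (BlockNorm.ofBlocks g (liftBlk blk ι))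
      ((mulOp (fun p : X × ι => χtX k p.1) ∘ₗ N k) ∘ₗ (unstackM (Cc k) (Ac k) + NVc k ∘ₗ projO (none : Option (J ⊕ J))) ∘ₗ
        stack LinearMap.id (fun j => Sum.elim (fun μ => fgrad n (liftEquiv (τ μ) ι)) (fun μ => bgrad n (liftEquiv (τ μ) ι)) j) ∘ₗ mulOp (fun p : X × ι => χX k p.1))
      (fun y y' => θA * Real.exp (-(δW * g.dist y y'))))
    (hqA : θA * cr < 1)
    -- per cube: the partition, its supports inside `ψ_k`, `χ_k` and its transition layers inside the cut (also shifted by `e_ν`); the partition of unity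
    (hhabs : ∀ k x, |hX k x| ≤ 1)
   
    (hh1 : ∀ k μ x, |fgrad n (τ μ) (hX k) x| ≤ c₁) (hh1b : ∀ k μ x, |bgrad n (τ μ) (hX k) x| ≤ c₁) (hh0 : ∀ k μ x, |hX k (τ μ x) - hX k x| ≤ c₀)
    (hLip : ∀ k y y', |hb k y - hb k y'| ≤ ℓ * g.dist y y') (hrh : ∀ k x, |hX k x - hb k (blk x)| ≤ ω)
    (hh2 : ∀ k μ p, |fgradAdj n (liftEquiv (τ μ) ι) (fgrad n (liftEquiv (τ μ) ι) (fun p : X × ι => hX k p.1)) p| ≤ c₂)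
    (hh2f : ∀ k μ p, |fgrad n (liftEquiv (τ μ) ι) (fgrad n (liftEquiv (τ μ) ι) (fun p : X × ι => hX k p.1)) p| ≤ c₂)
    (hh2b : ∀ k μ p, |bgrad n (liftEquiv (τ μ) ι) (bgrad n (liftEquiv (τ μ) ι) (fun p : X × ι => hX k p.1) ∘ ⇑(liftEquiv (τ μ) ι)) p| ≤ c₂)
    (hlayf : ∀ k μ x, hX k x ≠ hX k ((τ μ).symm x) → χX k x = 1) (hlayb : ∀ k μ x, hX k (τ μ x) ≠ hX k x → χX k x = 1) (h236 : ∀ p : X × ι, ∑ k, (fun p : X × ι => hX k p.1) p ^ 2 = 1)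
    -- per cube: species rows of the cut coefficients, the flat nonlocal commutator letter, base part; overlap
    (hA : ∀ k j x i, ∑ l, |Ac k j x i l| ≤ rA)
    (hKN : ∀ k, HasMaj (BlockNorm.ofBlocks g (liftBlk blk ι)) (BlockNorm.ofBlocks g (liftBlk blk ι)) (commOp NL (fun p : X × ι => hX k p.1)) (fun y y' => cN * Real.exp (-(ρN * g.dist y y'))))
    (hNV : ∀ k, HasMaj (BlockNorm.ofBlocks g (liftBlk blk ι)) (BlockNorm.ofBlocks g (liftBlk blk ι)) (NVc k) (fun y y' => RN * Real.exp (-(δN * g.dist y y'))))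
    (hN : ∀ a, ∑ k, ind (Sk k) a ≤ Nov)
    -- THE GLOBAL OPERATOR read in cube `k` = the cube's model operator + a far defect `F_k`; its adjoint commutator row; the TRUE right-locality defect and its row; a right inverse
    (hcov : ∀ k, Δ = (lapOp n (fun μ => liftEquiv (τ μ) ι) 0 + NL - (unstackM (Cc k) (Ac k) + NVc k ∘ₗ projO (none : Option (J ⊕ J))) ∘ₗ
      stack LinearMap.id (fun j => Sum.elim (fun μ => fgrad n (liftEquiv (τ μ) ι)) (fun μ => bgrad n (liftEquiv (τ μ) ι)) j)) + F k)
    (hFK : ∀ k, HasMaj (BlockNorm.ofBlocks g (liftBlk blk ι)) (BlockNorm.ofBlocks g (liftBlk blk ι)) ((projO none ∘ₗ bgPropV (stack (mulOp (fun p : X × ι => χtX k p.1) ∘ₗ N k) (fun j => Sum.elim (fun μ => fgrad n (liftEquiv (τ μ) ι)) (fun μ => bgrad n (liftEquiv (τ μ) ι)) j ∘ₗ (mulOp (fun p : X × ι => χtX k p.1) ∘ₗ N k))) (unstackM (Cc k) (Ac k) + NVc k ∘ₗ projO (none : Option (J ⊕ J)))) ∘ₗ commOp (F k) (fun p : X ×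 ι => hX k p.1))
      (fun y y' => ind (Sk k) y * (θF * Real.exp (-(ρ₃ * g.dist y y')))))
    (hloc : ∀ k, (projO none ∘ₗ bgPropV (stack (mulOp (fun p : X × ι => χtX k p.1) ∘ₗ N k) (fun j => Sum.elim (fun μ => fgrad n (liftEquiv (τ μ) ι)) (fun μ => bgrad n (liftEquiv (τ μ) ι)) j ∘ₗ (mulOp (fun p : X × ι => χtX k p.1) ∘ₗ N k))) (unstackM (Cc k) (Ac k) + NVc k ∘ₗ projO (none : Option (J ⊕ J)))) ∘ₗ Δ ∘ₗ mulOp (fun p : X × ι => hX k p.1) =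
      mulOp (fun p : X × ι => hX k p.1) + Ed k)
    (hEd : ∀ k, HasMaj (BlockNorm.ofBlocks g (liftBlk blk ι)) (BlockNorm.ofBlocks g (liftBlk blk ι)) (Ed k) (fun y y' => ind (Sk k) y * ind (Sk k) y' * (εE * Real.exp (-(ρ₃ * g.dist y y')))))
    (hqL : Nov * ((((((Fintype.card J : ℝ) * (3 * ((β + (β₁ + ct * β)) * (1 - (β + (β₁ + ct * β)) * (R * cr) * cr)⁻¹ * c₂) + 2 * (((1 - θA * cr)⁻¹ * βQ * cr) * c₁)) + 0)
          + (β + (β₁ + ct * β)) * (1 - (β + (β₁ + ct * β)) * (R * cr) * cr)⁻¹ * cN * cr)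
        + (((Fintype.card J : ℝ) * (2 * rA * (c₁ * ((β + (β₁ + ct * β)) * (1 - (β + (β₁ + ct * β)) * (R * cr) * cr)⁻¹) + c₀ * ((1 - θA * cr)⁻¹ * βQ * cr))))
          + (β + (β₁ + ct * β)) * (1 - (β + (β₁ + ct * β)) * (R * cr) * cr)⁻¹ * ((ℓ * (Real.exp 1 * ε)⁻¹ + 2 * ω) * RN) * cr)) + θF) + εE) * cr < 1) :
    glueInvL (remainderL Δ (fun k => fun p : X × ι => hX k p.1) (fun k => (projO none ∘ₗ bgPropV (stack (mulOp (fun p : X × ι => χtX k p.1) ∘ₗ N k) (fun j => Sum.elim (fun μ => fgrad n (liftEquiv (τ μ) ι)) (fun μ => bgrad n (liftEquiv (τ μ) ι)) j ∘ₗ (mulOp (fun p : X × ι => χtX k p.1) ∘ₗ N k))) (unstackM (Cc k) (Ac k) + NVc k ∘ₗ projO (none : Option (J ⊕ J))))) -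
          ∑ k, mulOp (fun p : X × ι => hX k p.1) ∘ₗ Ed k)
        (parametrix (fun k => fun p : X × ι => hX k p.1) (fun k => (projO none ∘ₗ bgPropV (stack (mulOp (fun p : X × ι => χtX k p.1) ∘ₗ N k) (fun j => Sum.elim (fun μ => fgrad n (liftEquiv (τ μ) ι)) (fun μ => bgrad n (liftEquiv (τ μ) ι)) j ∘ₗ (mulOp (fun p : X × ι => χtX k p.1) ∘ₗ N k))) (unstackM (Cc k) (Ac k) + NVc k ∘ₗ projO (none : Option (J ⊕ J)))))) ∘ₗ Δ = LinearMap.id ∧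
      Δ ∘ₗ glueInvL (remainderL Δ (fun k => fun p : X × ι => hX k p.1) (fun k => (projO none ∘ₗ bgPropV (stack (mulOp (fun p : X × ι => χtX k p.1) ∘ₗ N k) (fun j => Sum.elim (fun μ => fgrad n (liftEquiv (τ μ) ι)) (fun μ => bgrad n (liftEquiv (τ μ) ι)) j ∘ₗ (mulOp (fun p : X × ι => χtX k p.1) ∘ₗ N k))) (unstackM (Cc k) (Ac k) + NVc k ∘ₗ projO (none : Option (J ⊕ J))))) -
          ∑ k, mulOp (fun p : X × ι => hX k p.1) ∘ₗ Ed k)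
        (parametrix (fun k => fun p : X × ι => hX k p.1) (fun k => (projO none ∘ₗ bgPropV (stack (mulOp (fun p : X × ι => χtX k p.1) ∘ₗ N k) (fun j => Sum.elim (fun μ => fgrad n (liftEquiv (τ μ) ι)) (fun μ => bgrad n (liftEquiv (τ μ) ι)) j ∘ₗ (mulOp (fun p : X × ι => χtX k p.1) ∘ₗ N k))) (unstackM (Cc k) (Ac k) + NVc k ∘ₗ projO (none : Option (J ⊕ J)))))) = LinearMap.id := by
  have hK := hasMaj_smoothCutDressed_comp_commOp_global blk τ n htri hd hsymm hd0 hrow hσ hβ hβ₁ hβQ hct hR hcr hc₀ hc₁ hc₂ hcN hrA hRN hℓ hω hθA hε hσρ hρ₁V hρ₁G hρ₂ hρ₂₁ hρ₃ hρ₃N hρ₃V hρ₃₂ hρ₂W hSχ hSψ hSψ₂ hχt hdχt hdχtb hsub hχ hs hsb hdd hddb hNψ hcut hcutF hcutB hTf hTb hTfr hTbr hTfψ hTbψ hV hq hW𝒲 hqA hh1 hh1b hh0 hLip hrh hh2 hh2f hh2b hlayf hlayb hA hKN hNV hcov hFK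
  have hΘF : 0 ≤ (((((Fintype.card J : ℝ) * (3 * ((β + (β₁ + ct * β)) * (1 - (β + (β₁ + ct * β)) * (R * cr) * cr)⁻¹ * c₂) + 2 * (((1 - θA * cr)⁻¹ * βQ * cr) * c₁)) + 0)
          + (β + (β₁ + ct * β)) * (1 - (β + (β₁ + ct * β)) * (R * cr) * cr)⁻¹ * cN * cr)
        + (((Fintype.card J : ℝ) * (2 * rA * (c₁ * ((β + (β₁ + ct * β)) * (1 - (β + (β₁ + ct * β)) * (R * cr) * cr)⁻¹) + c₀ * ((1 - θA * cr)⁻¹ * βQ * cr))))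
          + (β + (β₁ + ct * β)) * (1 - (β + (β₁ + ct * β)) * (R * cr) * cr)⁻¹ * ((ℓ * (Real.exp 1 * ε)⁻¹ + 2 * ω) * RN) * cr)) + θF) := by
    have hB : 0 ≤ ((β + (β₁ + ct * β)) * (1 - (β + (β₁ + ct * β)) * (R * cr) * cr)⁻¹) := mul_nonneg (by positivity) (inv_nonneg.2 (by linarith))
    have hinv : 0 ≤ (1 - θA * cr)⁻¹ := inv_nonneg.2 (by linarith)
    have hBX : 0 ≤ ((1 - θA * cr)⁻¹ * βQ * cr) := mul_nonneg (mul_nonneg hinv hβQ) hcr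
    positivity
  have hR := hasMaj_remainderLD_out (liftBlk blk ι) Sk hΘF hεE (fun k p => hhabs k p.1) hN hK hEd
  exact glued_adjoint_inverse_of_defect (liftBlk blk ι) hd hrow (mul_nonneg hNov (add_nonneg hΘF hεE)) (by linarith : σ ≤ ρ₃) h236 hloc hR hqL

set_option maxHeartbeats 400000 in
/-- ★★ **… HENCE IT EQUALS EVERY RIGHT INVERSE `Y` OF THE GLOBAL OPERATOR** (FILE 147 `glueInvL_eq_of_lap_comp`) — at the cover `Y := cvGlued` (FILE 133), so the adjoint arrangement's entries ARE the
live glued propagator's. [cite: Balaban1984PropagatorsII, (2.91) p.239 + p.247 (mechanism)] -/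
theorem glued_adjoint_eq_rightInverse (htri : Triangle254 g) (hd : ∀ a b : g.Site, 0 ≤ g.dist a b) (hsymm : ∀ y y', g.dist y y' = g.dist y' y) (hd0 : ∀ y : g.Site, g.dist y y = 0) (hrow : RowSum g σ cr) (hσ : 0 ≤ σ)
    {ρ₁ ρ₂ ρ₃ ρN δV δN δW ε R c₀ c₁ c₂ cN rA RN ℓ ω β β₁ ct δ βQ θA θF εE Nov : ℝ} (hβ : 0 ≤ β) (hβ₁ : 0 ≤ β₁) (hβQ : 0 ≤ βQ) (hct : 0 ≤ ct) (hR : 0 ≤ R) (hcr : 0 ≤ cr) (hc₀ : 0 ≤ c₀)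
    (hc₁ : 0 ≤ c₁) (hc₂ : 0 ≤ c₂) (hcN : 0 ≤ cN) (hrA : 0 ≤ rA) (hRN : 0 ≤ RN) (hℓ : 0 ≤ ℓ) (hω : 0 ≤ ω) (hθA : 0 ≤ θA) (hθF : 0 ≤ θF) (hεE : 0 ≤ εE) (hNov : 0 ≤ Nov) (hε : 0 < ε) (hσρ : σ ≤ ρ₁)
    (hρ₁V : ρ₁ ≤ δV) (hρ₁G : ρ₁ + σ ≤ δ) (hρ₂ : 0 ≤ ρ₂) (hρ₂₁ : ρ₂ + σ ≤ ρ₁) (hρ₃ : 0 ≤ ρ₃) (hρ₃N : ρ₃ ≤ ρN) (hρ₃V : ρ₃ ≤ δN - ε) (hρ₃₂ : ρ₃ + σ ≤ ρ₂) (hρ₂W : ρ₂ + 2 * σ ≤ δW)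
    (hσρ₃ : 2 * σ ≤ ρ₃)
    -- per cube: cuts (supports over `S_k`, bump letters and insertions, input cuts)
    (hSχ : ∀ k x, χX k x ≠ 0 → blk x ∈ Sk k) (hSψ : ∀ k x, ψX k x ≠ 0 → blk x ∈ Sk k) (hSψ₂ : ∀ k x, ψ₂X k x ≠ 0 → blk x ∈ Sk k) (hχt : ∀ k x, |χtX k x| ≤ 1)
    (hdχt : ∀ k μ p, |fgrad n (liftEquiv (τ μ) ι) (fun p : X × ι => χtX k p.1) p| ≤ ct) (hdχtb : ∀ k μ p, |bgrad n (liftEquiv (τ μ) ι) (fun p : X × ι => χtX k p.1) p| ≤ ct)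
    (hsub : ∀ k, mulOp (fun p : X × ι => χtX k p.1) ∘ₗ mulOp (fun p : X × ι => χX k p.1) = mulOp (fun p : X × ι => χtX k p.1))
    (hχ : ∀ k, mulOp (fun p : X × ι => χX k p.1) ∘ₗ mulOp (fun p : X × ι => χtX k p.1) = mulOp (fun p : X × ι => χtX k p.1))
    (hs : ∀ k μ, mulOp ((fun p : X × ι => χtX k p.1) ∘ (liftEquiv (τ μ) ι)) ∘ₗ mulOp (fun p : X × ι => χX k p.1) = mulOp ((fun p : X × ι => χtX k p.1) ∘ (liftEquiv (τ μ) ι)))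
    (hsb : ∀ k μ, mulOp ((fun p : X × ι => χtX k p.1) ∘ (liftEquiv (τ μ) ι).symm) ∘ₗ mulOp (fun p : X × ι => χX k p.1) = mulOp ((fun p : X × ι => χtX k p.1) ∘ (liftEquiv (τ μ) ι).symm))
    (hdd : ∀ k μ, mulOp (fgrad n (liftEquiv (τ μ) ι) (fun p : X × ι => χtX k p.1)) ∘ₗ mulOp (fun p : X × ι => χX k p.1) = mulOp (fgrad n (liftEquiv (τ μ) ι) (fun p : X × ι => χtX k p.1)))
    (hddb : ∀ k μ, mulOp (bgrad n (liftEquiv (τ μ) ι) (fun p : X × ι => χtX k p.1)) ∘ₗ mulOp (fun p : X × ι => χX k p.1) = mulOp (bgrad n (liftEquiv (τ μ) ι) (fun p : X × ι => χtX k p.1)))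
    (hNψ : ∀ k, N k ∘ₗ mulOp (fun p : X × ι => ψX k p.1) = N k)
    -- per cube: the flat cube's cut rows, SANDWICHED right entries with rows and input cuts
    (hcut : ∀ k, HasMaj (BlockNorm.ofBlocks g (liftBlk blk ι)) (BlockNorm.ofBlocks g (liftBlk blk ι)) (mulOp (fun p : X × ι => χX k p.1) ∘ₗ N k) (fun y y' => ind (Sk k) y * ind (Sk k) y' * (β * Real.exp (-(δ * g.dist y y')))))
    (hcutF : ∀ k μ, HasMaj (BlockNorm.ofBlocks g (liftBlk blk ι)) (BlockNorm.ofBlocks g (liftBlk blk ι)) (mulOp (fun p : X × ι => χX k p.1) ∘ₗ (fgrad n (liftEquiv (τ μ) ι) ∘ₗ N k)) (fun y y' => ind (Sk k) y * ind (Sk k) y' * (β₁ * Real.exp (-(δ * g.dist y y')))))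
    (hcutB : ∀ k μ, HasMaj (BlockNorm.ofBlocks g (liftBlk blk ι)) (BlockNorm.ofBlocks g (liftBlk blk ι)) (mulOp (fun p : X × ι => χX k p.1) ∘ₗ (bgrad n (liftEquiv (τ μ) ι) ∘ₗ N k)) (fun y y' => ind (Sk k) y * ind (Sk k) y' * (β₁ * Real.exp (-(δ * g.dist y y')))))
    (hTf : ∀ k μ, N k ∘ₗ fgrad n (liftEquiv (τ μ) ι) ∘ₗ mulOp (fun p : X × ι => χX k p.1) = Tf k μ ∘ₗ mulOp (fun p : X × ι => χX k p.1))
    (hTb : ∀ k μ, N k ∘ₗ bgrad n (liftEquiv (τ μ) ι) ∘ₗ mulOp (fun p : X × ι => χX k p.1) = Tb k μ ∘ₗ mulOp (fun p : X × ι => χX k p.1))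
    (hTfr : ∀ k μ, HasMaj (BlockNorm.ofBlocks g (liftBlk blk ι)) (BlockNorm.ofBlocks g (liftBlk blk ι)) (Tf k μ) (fun y y' => ind (Sk k) y * ind (Sk k) y' * (βQ * Real.exp (-(δW * g.dist y y')))))
    (hTbr : ∀ k μ, HasMaj (BlockNorm.ofBlocks g (liftBlk blk ι)) (BlockNorm.ofBlocks g (liftBlk blk ι)) (Tb k μ) (fun y y' => ind (Sk k) y * ind (Sk k) y' * (βQ * Real.exp (-(δW * g.dist y y')))))
    (hTfψ : ∀ k μ, Tf k μ ∘ₗ mulOp (fun p : X × ι => ψ₂X k p.1) = Tf k μ) (hTbψ : ∀ k μ, Tb k μ ∘ₗ mulOp (fun p : X × ι => ψ₂X k p.1) = Tb k μ)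
    -- per cube: the cut perturbation's letter, smallness, the adjoint letter of `𝒲_k`
    (hV : ∀ k, HasMaj (BlockNorm.ofBlocks g (blkPair (liftBlk blk ι))) (BlockNorm.ofBlocks g (liftBlk blk ι)) (unstackM (Cc k) (Ac k) + NVc k ∘ₗ projO (none : Option (J ⊕ J))) (fun y y' => R * Real.exp (-(δV * g.dist y y'))))
    (hq : (β + (β₁ + ct * β)) * (R * cr) * cr < 1)
    (hW𝒲 : ∀ k, HasMaj (BlockNorm.ofBlocks g (liftBlk blk ι)) (BlockNorm.ofBlocks g (liftBlk blk ι))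
      ((mulOp (fun p : X × ι => χtX k p.1) ∘ₗ N k) ∘ₗ (unstackM (Cc k) (Ac k) + NVc k ∘ₗ projO (none : Option (J ⊕ J))) ∘ₗ
        stack LinearMap.id (fun j => Sum.elim (fun μ => fgrad n (liftEquiv (τ μ) ι)) (fun μ => bgrad n (liftEquiv (τ μ) ι)) j) ∘ₗ mulOp (fun p : X × ι => χX k p.1))
      (fun y y' => θA * Real.exp (-(δW * g.dist y y'))))
    (hqA : θA * cr < 1)
    -- per cube: the partition, its supports inside `ψ_k`, `χ_k` and its transition layers inside the cut (also shifted by `e_ν`); the partition of unity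
    (hhabs : ∀ k x, |hX k x| ≤ 1)
   
    (hh1 : ∀ k μ x, |fgrad n (τ μ) (hX k) x| ≤ c₁) (hh1b : ∀ k μ x, |bgrad n (τ μ) (hX k) x| ≤ c₁) (hh0 : ∀ k μ x, |hX k (τ μ x) - hX k x| ≤ c₀)
    (hLip : ∀ k y y', |hb k y - hb k y'| ≤ ℓ * g.dist y y') (hrh : ∀ k x, |hX k x - hb k (blk x)| ≤ ω)
    (hh2 : ∀ k μ p, |fgradAdj n (liftEquiv (τ μ) ι) (fgrad n (liftEquiv (τ μ) ι) (fun p : X × ι => hX k p.1)) p| ≤ c₂)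
    (hh2f : ∀ k μ p, |fgrad n (liftEquiv (τ μ) ι) (fgrad n (liftEquiv (τ μ) ι) (fun p : X × ι => hX k p.1)) p| ≤ c₂)
    (hh2b : ∀ k μ p, |bgrad n (liftEquiv (τ μ) ι) (bgrad n (liftEquiv (τ μ) ι) (fun p : X × ι => hX k p.1) ∘ ⇑(liftEquiv (τ μ) ι)) p| ≤ c₂)
    (hlayf : ∀ k μ x, hX k x ≠ hX k ((τ μ).symm x) → χX k x = 1) (hlayb : ∀ k μ x, hX k (τ μ x) ≠ hX k x → χX k x = 1) (h236 : ∀ p : X × ι, ∑ k, (fun p : X × ι => hX k p.1) p ^ 2 = 1)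
    -- per cube: species rows of the cut coefficients, the flat nonlocal commutator letter, base part; overlap
    (hA : ∀ k j x i, ∑ l, |Ac k j x i l| ≤ rA)
    (hKN : ∀ k, HasMaj (BlockNorm.ofBlocks g (liftBlk blk ι)) (BlockNorm.ofBlocks g (liftBlk blk ι)) (commOp NL (fun p : X × ι => hX k p.1)) (fun y y' => cN * Real.exp (-(ρN * g.dist y y'))))
    (hNV : ∀ k, HasMaj (BlockNorm.ofBlocks g (liftBlk blk ι)) (BlockNorm.ofBlocks g (liftBlk blk ι)) (NVc k) (fun y y' => RN * Real.exp (-(δN * g.dist y y'))))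
    (hN : ∀ a, ∑ k, ind (Sk k) a ≤ Nov)
    -- THE GLOBAL OPERATOR read in cube `k` = the cube's model operator + a far defect `F_k`; its adjoint commutator row; the TRUE right-locality defect and its row; a right inverse
    (hcov : ∀ k, Δ = (lapOp n (fun μ => liftEquiv (τ μ) ι) 0 + NL - (unstackM (Cc k) (Ac k) + NVc k ∘ₗ projO (none : Option (J ⊕ J))) ∘ₗ
      stack LinearMap.id (fun j => Sum.elim (fun μ => fgrad n (liftEquiv (τ μ) ι)) (fun μ => bgrad n (liftEquiv (τ μ) ι)) j)) + F k)
    (hFK : ∀ k, HasMaj (BlockNorm.ofBlocks g (liftBlk blk ι)) (BlockNorm.ofBlocks g (liftBlk blk ι)) ((projO none ∘ₗ bgPropV (stack (mulOp (fun p : X × ι => χtX k p.1) ∘ₗ N k) (fun j => Sum.elim (fun μ => fgrad n (liftEquiv (τ μ) ι)) (fun μ => bgrad n (liftEquiv (τ μ) ι)) j ∘ₗ (mulOp (fun p : X × ι => χtX k p.1) ∘ₗ N k))) (unstackM (Cc k) (Ac k) + NVc k ∘ₗ projO (none : Option (J ⊕ J)))) ∘ₗ commOp (F k) (fun p : X ×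 ι => hX k p.1))
      (fun y y' => ind (Sk k) y * (θF * Real.exp (-(ρ₃ * g.dist y y')))))
    (hloc : ∀ k, (projO none ∘ₗ bgPropV (stack (mulOp (fun p : X × ι => χtX k p.1) ∘ₗ N k) (fun j => Sum.elim (fun μ => fgrad n (liftEquiv (τ μ) ι)) (fun μ => bgrad n (liftEquiv (τ μ) ι)) j ∘ₗ (mulOp (fun p : X × ι => χtX k p.1) ∘ₗ N k))) (unstackM (Cc k) (Ac k) + NVc k ∘ₗ projO (none : Option (J ⊕ J)))) ∘ₗ Δ ∘ₗ mulOp (fun p : X × ι => hX k p.1) =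
      mulOp (fun p : X × ι => hX k p.1) + Ed k)
    (hEd : ∀ k, HasMaj (BlockNorm.ofBlocks g (liftBlk blk ι)) (BlockNorm.ofBlocks g (liftBlk blk ι)) (Ed k) (fun y y' => ind (Sk k) y * ind (Sk k) y' * (εE * Real.exp (-(ρ₃ * g.dist y y')))))
    (hqL : Nov * ((((((Fintype.card J : ℝ) * (3 * ((β + (β₁ + ct * β)) * (1 - (β + (β₁ + ct * β)) * (R * cr) * cr)⁻¹ * c₂) + 2 * (((1 - θA * cr)⁻¹ * βQ * cr) * c₁)) + 0)
          + (β + (β₁ + ct * β)) * (1 - (β + (β₁ + ct * β)) * (R * cr) * cr)⁻¹ * cN * cr)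
        + (((Fintype.card J : ℝ) * (2 * rA * (c₁ * ((β + (β₁ + ct * β)) * (1 - (β + (β₁ + ct * β)) * (R * cr) * cr)⁻¹) + c₀ * ((1 - θA * cr)⁻¹ * βQ * cr))))
          + (β + (β₁ + ct * β)) * (1 - (β + (β₁ + ct * β)) * (R * cr) * cr)⁻¹ * ((ℓ * (Real.exp 1 * ε)⁻¹ + 2 * ω) * RN) * cr)) + θF) + εE) * cr < 1) (hY : Δ ∘ₗ Yop = LinearMap.id) :
    glueInvL (remainderL Δ (fun k => fun p : X × ι => hX k p.1) (fun k => (projO none ∘ₗ bgPropV (stack (mulOp (fun p : X × ι => χtX k p.1) ∘ₗ N k) (fun j => Sum.elim (fun μ => fgrad n (liftEquiv (τ μ) ι)) (fun μ => bgrad n (liftEquiv (τ μ) ι)) j ∘ₗ (mulOp (fun p : X × ι => χtX k p.1) ∘ₗ N k))) (unstackM (Cc k) (Ac k) + NVc k ∘ₗ projO (none : Option (J ⊕ J))))) -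
          ∑ k, mulOp (fun p : X × ι => hX k p.1) ∘ₗ Ed k)
        (parametrix (fun k => fun p : X × ι => hX k p.1) (fun k => (projO none ∘ₗ bgPropV (stack (mulOp (fun p : X × ι => χtX k p.1) ∘ₗ N k) (fun j => Sum.elim (fun μ => fgrad n (liftEquiv (τ μ) ι)) (fun μ => bgrad n (liftEquiv (τ μ) ι)) j ∘ₗ (mulOp (fun p : X × ι => χtX k p.1) ∘ₗ N k))) (unstackM (Cc k) (Ac k) + NVc k ∘ₗ projO (none : Option (J ⊕ J)))))) = Yop :=
  glueInvL_eq_of_lap_comp (glued_adjoint_inverse_trueDefect blk τ n htri hd hsymm hd0 hrow hσ hβ hβ₁ hβQ hct hR hcr hc₀ hc₁ hc₂ hcN hrA hRN hℓ hω hθA hθF hεE hNov hε hσρ hρ₁V hρ₁G hρ₂ hρ₂₁ hρ₃ hρ₃N hρ₃V hρ₃₂ hρ₂W hσρ₃ hSχ hSψ hSψ₂ hχt hdχt hdχtb hsub hχ hs hsb hdd hddb hNψ hcut hcutF hcutB hTf hTb hTfr hTbr hTfψ hTbψ hV hq hW𝒲 hqA hhabs hh1 hh1b hh0 hLip hrh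 hh2 hh2f hh2b hlayf hlayb h236 hA hKN hNV hN hcov hFK hloc hEd hqL).1 hY

end Capstone

end Summit.QuantumFields.YangMills.BalabanUVNodes.N15.Gluing

end
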